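import Summits.QuantumFields.BalabanUV.Beta.FP.HorizontalModel

/-!
# `BalabanUV.Beta.FP.KKTSecondVariation` — road «FP» for binder row D1, model row RHOA-10 (owner memo `GAMMA-DESIGN.md` §1,
# «THE ONE SHOT IN KKT FORM»): THE SECOND VARIATION OF `−½·log|det kkt(H(t),Q(t))|` IS SIX LOOPS WHOSE LEGS ARE THE THREE BLOCKS OF THE
# BORDERED INVERSE — fluctuation covariance `Γ = flucCov`, minimiser `𝓘 = minOp`, effective form `𝔊 = effForm`

HONEST DEPENDENCY (page 1, mandatory): continuum YM on T⁴ ⇐ BetaPertH ∧ nine spine estimates (0/9 proved); BetaPertH ⇐ (D1) ∧ (D4) ∧ CAP+tail;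
G-an2-4 gates asym, D1 and NE2/3/4.  HONEST FRAMING (cell contract, verbatim): «discharging `BetaPertH` makes Bałaban's UV stability UNCONDITIONAL —
a real constructive-QFT result; it is NOT the continuum limit and NOT the Clay problem.»  THIS MODULE DISCHARGES NOTHING of the wall: it is [folklore]
finite-dimensional block algebra of traces ∕ one-variable calculus over the tree's `Beta.CompositionSingular` (`kkt`, `flucCov`, `minOp`, `minOpL`,
`effForm`, `kktInv_eq_fromBlocks`, `minOpL_eq_transpose`), road BF-x's `D1BFx.LogDetSecondVariation` (`secondVar`, `hasDerivAt_logAbsDet`,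
`hasDerivAt_trace_inv_mul`) and `D1BFx.SliceTransferModel` (`hasDerivAt_kkt`).  No `def`, no `def … : Prop`, no cited fact, 0 sorry; 0 wall binders
touched; NOT D1, NOT BetaPertH, NOT continuum, NOT Clay.

ABSOLUTE RULE (cell charter, verbatim): «No internally-minted statement may enter as a cited fact. Every hypothesis is either kernel-proved in this package or a
verbatim quotation of a PUBLISHED theorem with page reference. The manuscript(s) under audit are NOT citable for their own disputed steps — they are the thing
under adjudication; programme-internal (2001/route/tribunal) claims are never citable.»

THE STATEMENT (owner memo `HOME/b2b-balaban-beta-d1-p3/GAMMA-DESIGN.md` 3955a07907a83e5a §1, verbatim): with `𝕂 := kkt(H, Q)`,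
`𝕂⁻¹ = [[Γ, 𝓘],[𝓘ᵀ, −𝔊]]` (`Γ = flucCov`, `𝓘 = minOp`, `𝔊 = effForm`), `𝕂̇ = [[Ḣ, Q̇ᵀ],[Q̇, 0]]`, `𝕂̈ = [[Ḧ, Q̈ᵀ],[Q̈, 0]]` (`Ḣ` symmetric) and
`δ²(−½log|det 𝕂|) = −½tr(𝕂⁻¹𝕂̈) + ½tr(𝕂⁻¹𝕂̇𝕂⁻¹𝕂̇)`:
  `T^{gl} = ½tr(ΓḢΓḢ) − ½tr(ΓḦ) + 2tr(ΓḢ𝓘Q̇) + tr(𝓘Q̇𝓘Q̇) − tr(𝔊·Q̇ΓQ̇ᵀ) − tr(𝓘Q̈)`   (six loops);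
checks: `Q̇ = 0 ⟹ ½tr(ΓḢΓḢ) − ½tr(ΓḦ)`; `Ḣ = 0 ⟹` first variation `−tr(𝓘Q̇)` (the constraint Jacobian).

CONTENT.
§1 ALGEBRA (NO invertibility hypothesis: both sides are written with the same `(kkt H Q)⁻¹`, whose four blocks ARE `flucCov ∕ minOp ∕ minOpL ∕ −effForm` by
definition, `kktInv_eq_fromBlocks`):
* `trace_kktInv_mul_kkt` — `tr(𝕂⁻¹·kkt H₁ Q₁) = tr(Γ H₁) + tr(𝓘 Q₁) + tr(minOpL H Q · Q₁ᵀ)` (any field); `trace_kktInv_mul_kkt_symm` — `= tr(Γ H₁) + 2·tr(𝓘 Q₁)`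
  for `Hᵀ = H`; `firstVar_kkt_of_H_static` — at `H₁ = 0`: `−½·tr(𝕂⁻¹𝕂̇) = −tr(𝓘 Q₁)` (CHECK 2).
* `secondVar_kkt_blocks` — the raw four-block expansion of `secondVar 𝕂 (kkt H₁ Q₁) (kkt H₂ Q₂)` (no symmetry); `secondVar_kkt` — for `Hᵀ = H`, `H₁ᵀ = H₁`:
  `secondVar 𝕂 (kkt H₁ Q₁) (kkt H₂ Q₂) = tr(Γ H₂) + 2tr(𝓘 Q₂) − tr(Γ H₁ Γ H₁) − 4tr(Γ H₁ 𝓘 Q₁) − 2tr(𝓘 Q₁ 𝓘 Q₁) + 2tr(𝔊 Q₁ Γ Q₁ᵀ)`;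
  `sixLoops_kkt` — the memo's display `−½·secondVar … = ½tr(ΓH₁ΓH₁) − ½tr(ΓH₂) + 2tr(ΓH₁𝓘Q₁) + tr(𝓘Q₁𝓘Q₁) − tr(𝔊·Q₁ΓQ₁ᵀ) − tr(𝓘Q₂)` VERBATIM;
  `sixLoops_kkt_of_Q_static` — at `Q₁ = Q₂ = 0`: `= ½tr(ΓH₁ΓH₁) − ½tr(ΓH₂)` (CHECK 1).
§2 CALCULUS over `ℝ` (binders in the style of `HorizontalModel.secondVar_threeSystems`: curves `ℝ → ι → ι → ℝ` read through `Matrix.of`):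
* `hasDerivAt_logAbsDet_kkt` — `(log|det kkt(H,Q)|)′(t) = tr(Γ_t·H₁) + 2tr(𝓘_t·Q₁)` at any `t` with `det kkt(H t)(Q t) ≠ 0`, `H t` symmetric;
  `hasDerivAt_negHalfLogAbsDet_kkt` — the `−½` multiple: `−½tr(Γ_t H₁) − tr(𝓘_t Q₁)`.
* `hasDerivAt_firstVar_kkt` — `(u ↦ tr(kkt(H u,Q u)⁻¹·kkt(H₁ u,Q₁ u)))′(t) = secondVar (kkt (H t) (Q t)) (kkt (H₁ t) (Q₁ t)) (kkt H₂ Q₂)`;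
  `hasDerivAt_negHalfFirstVar_kkt` — **THE ONE SHOT**: the first variation `u ↦ −½tr(𝕂(u)⁻¹𝕂̇(u))` has derivative `T^{gl}` = the six loops at `t`
  (`H t`, `H₁ t` symmetric).
READING (orientation only, nothing asserted): on road FP `H = H_cov(B)`, `Q = Q_B`, `B = U_nV`; `Γ`, `𝓘`, `𝔊` become `G₁ − G₁Qᵀ(1+𝔊)QG₁`, `G₁Qᵀ(1+𝔊)`,
`n⁻⁴Δ_∞^c` by the tilt dictionary (row GAMMA-2) — NOT here.  The λλ-corner statement «`((kkt H Q)⁻¹)₂₂ = −effForm H Q`» is `effForm`'s definition; its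
variational reading is row RHOA-1b — NOT here.
Provenance: cross-cell idle seat b2b-balaban-t4-ne7b-formalise-leaf-09 (gen 19, prover-b2b-balaban-t4-ne7b-formalise-leaf-09-g19-0) for road FP owner
b2b-balaban-beta-d1-p3, 2026-08-21 (journal INTENT «RHOA-10» l.23740).  [folklore], 0 def, 0 cite, 0 sorry.
-/

noncomputable section

namespace Summit.QuantumFields.BalabanUV.Beta.FP.KKTSecondVariation

open Matrix Filter Finset
open scoped Topology
open Literature.MathematicalPhysics.QuantumFieldTheory.Balaban1983to89.Beta.Composition (kkt)
open Literature.MathematicalPhysics.QuantumFieldTheory.Balaban1983to89.Beta.CompositionSingular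
  (effForm minOp minOpL flucCov kktInv_eq_fromBlocks kkt_eq_fromBlocks minOpL_eq_transpose)
open Summit.QuantumFields.BalabanUV.Beta.D1BFx.LogDetSecondVariation (secondVar hasDerivAt_logAbsDet hasDerivAt_trace_inv_mul)
open Summit.QuantumFields.BalabanUV.Beta.D1BFx.SliceTransferModel (hasDerivAt_kkt)

/-! ## §1 Algebra: traces of the bordered inverse against bordered jets -/

section Trace

variable {𝕜 : Type*} [Field 𝕜]
variable {ν μ : Type*} [Fintype ν] [Fintype μ] [DecidableEq ν] [DecidableEq μ]

omit [DecidableEq ν] [DecidableEq μ] in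
/-- [folklore] The trace of a square block matrix is the sum of the traces of its diagonal blocks. -/
theorem trace_fromBlocks_diag (A : Matrix ν ν 𝕜) (B : Matrix ν μ 𝕜) (C : Matrix μ ν 𝕜) (D : Matrix μ μ 𝕜) :
    (fromBlocks A B C D).trace = A.trace + D.trace := by
  simp [Matrix.trace, Matrix.diag, Fintype.sum_sum_type]

/-- [folklore] **FIRST VARIATION, four blocks**: `tr((kkt H Q)⁻¹ · kkt H₁ Q₁) = tr(Γ H₁) + tr(𝓘 Q₁) + tr(minOpL H Q · Q₁ᵀ)` with
`Γ = flucCov H Q`, `𝓘 = minOp H Q` — no hypothesis on `H`, `Q` (the blocks are those of `(kkt H Q)⁻¹` by definition). -/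
theorem trace_kktInv_mul_kkt (H H₁ : Matrix ν ν 𝕜) (Q Q₁ : Matrix μ ν 𝕜) :
    ((kkt H Q)⁻¹ * kkt H₁ Q₁).trace =
      (flucCov H Q * H₁).trace + (minOp H Q * Q₁).trace + (minOpL H Q * Q₁ᵀ).trace := by
  rw [kktInv_eq_fromBlocks, kkt_eq_fromBlocks H₁ Q₁, fromBlocks_multiply, trace_fromBlocks_diag]
  simp [trace_add, add_assoc]

/-- [folklore] **FIRST VARIATION, symmetric fine form**: for `Hᵀ = H` (so `minOpL = minOpᵀ`),
`tr((kkt H Q)⁻¹ · kkt H₁ Q₁) = tr(Γ H₁) + 2·tr(𝓘 Q₁)`. -/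
theorem trace_kktInv_mul_kkt_symm (H H₁ : Matrix ν ν 𝕜) (Q Q₁ : Matrix μ ν 𝕜) (hH : Hᵀ = H) :
    ((kkt H Q)⁻¹ * kkt H₁ Q₁).trace = (flucCov H Q * H₁).trace + 2 * (minOp H Q * Q₁).trace := by
  rw [trace_kktInv_mul_kkt, (minOpL_eq_transpose H Q hH).1, ← transpose_mul, trace_transpose, trace_mul_comm Q₁]
  ring

end Trace

section TraceReal

variable {ν μ : Type*} [Fintype ν] [Fintype μ] [DecidableEq ν] [DecidableEq μ]

/-- [folklore] **CHECK 2 of the memo** («`Ḣ = 0 ⟹` first variation `−tr(𝓘Q̇)` = the constraint Jacobian»): for `Hᵀ = H`,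
`−½·tr((kkt H Q)⁻¹ · kkt 0 Q₁) = −tr(minOp H Q · Q₁)` (over `ℝ`, where `½` makes sense). -/
theorem firstVar_kkt_of_H_static (H : Matrix ν ν ℝ) (Q Q₁ : Matrix μ ν ℝ) (hH : Hᵀ = H) :
    -(1 / 2 : ℝ) * ((kkt H Q)⁻¹ * kkt 0 Q₁).trace = -(minOp H Q * Q₁).trace := by
  rw [trace_kktInv_mul_kkt_symm H 0 Q Q₁ hH, Matrix.mul_zero, trace_zero, zero_add]
  ring

end TraceReal

/-! ## §1 (continued) The second variation in the three blocks: six loops -/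

section Second

variable {ν μ : Type*} [Fintype ν] [Fintype μ] [DecidableEq ν] [DecidableEq μ]

/-- [folklore] **SECOND VARIATION, raw four-block expansion** (no symmetry, no invertibility): with `Γ = flucCov H Q`, `𝓘 = minOp H Q`,
`L = minOpL H Q`, `𝔊 = effForm H Q`,
`secondVar (kkt H Q) (kkt H₁ Q₁) (kkt H₂ Q₂) = [tr(Γ H₂) + tr(𝓘 Q₂) + tr(L Q₂ᵀ)]`
`  − [tr((ΓH₁ + 𝓘Q₁)²) + 2·tr(ΓQ₁ᵀ·(LH₁ − 𝔊Q₁)) + tr((LQ₁ᵀ)²)]`. -/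
theorem secondVar_kkt_blocks (H H₁ H₂ : Matrix ν ν ℝ) (Q Q₁ Q₂ : Matrix μ ν ℝ) :
    secondVar (kkt H Q) (kkt H₁ Q₁) (kkt H₂ Q₂) =
      ((flucCov H Q * H₂).trace + (minOp H Q * Q₂).trace + (minOpL H Q * Q₂ᵀ).trace)
      - (((flucCov H Q * H₁ + minOp H Q * Q₁) * (flucCov H Q * H₁ + minOp H Q * Q₁)).trace
          + 2 * (flucCov H Q * Q₁ᵀ * (minOpL H Q * H₁ - effForm H Q * Q₁)).trace
          + (minOpL H Q * Q₁ᵀ * (minOpL H Q * Q₁ᵀ)).trace) := by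
  unfold secondVar
  have h2 := trace_kktInv_mul_kkt H H₂ Q Q₂
  have hM : (kkt H Q)⁻¹ * kkt H₁ Q₁ =
      fromBlocks (flucCov H Q * H₁ + minOp H Q * Q₁) (flucCov H Q * Q₁ᵀ)
        (minOpL H Q * H₁ - effForm H Q * Q₁) (minOpL H Q * Q₁ᵀ) := by
    rw [kktInv_eq_fromBlocks, kkt_eq_fromBlocks H₁ Q₁, fromBlocks_multiply]
    simp only [Matrix.mul_zero, add_zero, Matrix.neg_mul, sub_eq_add_neg]
  rw [h2, hM, fromBlocks_multiply, trace_fromBlocks_diag, trace_add, trace_add,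
    trace_mul_comm (minOpL H Q * H₁ - effForm H Q * Q₁) (flucCov H Q * Q₁ᵀ)]
  ring

/-- [folklore] **SECOND VARIATION IN THE THREE BLOCKS** (symmetric fine form and symmetric first jet, `Hᵀ = H`, `H₁ᵀ = H₁`; no invertibility):
`secondVar (kkt H Q) (kkt H₁ Q₁) (kkt H₂ Q₂)`
`  = tr(Γ H₂) + 2tr(𝓘 Q₂) − tr(Γ H₁ Γ H₁) − 4tr(Γ H₁ 𝓘 Q₁) − 2tr(𝓘 Q₁ 𝓘 Q₁) + 2tr(𝔊 Q₁ Γ Q₁ᵀ)`. -/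
theorem secondVar_kkt (H H₁ H₂ : Matrix ν ν ℝ) (Q Q₁ Q₂ : Matrix μ ν ℝ) (hH : Hᵀ = H) (hH₁ : H₁ᵀ = H₁) :
    secondVar (kkt H Q) (kkt H₁ Q₁) (kkt H₂ Q₂) =
      (flucCov H Q * H₂).trace + 2 * (minOp H Q * Q₂).trace
        - (flucCov H Q * H₁ * (flucCov H Q * H₁)).trace
        - 4 * (flucCov H Q * H₁ * (minOp H Q * Q₁)).trace
        - 2 * (minOp H Q * Q₁ * (minOp H Q * Q₁)).trace
        + 2 * (effForm H Q * Q₁ * (flucCov H Q * Q₁ᵀ)).trace := by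
  obtain ⟨hL, hΓ, -⟩ := minOpL_eq_transpose H Q hH
  rw [secondVar_kkt_blocks, hL]
  -- the second jet: `tr(𝓘ᵀ Q₂ᵀ) = tr(𝓘 Q₂)`
  have e2 : ((minOp H Q)ᵀ * Q₂ᵀ).trace = (minOp H Q * Q₂).trace := by
    rw [← transpose_mul, trace_transpose, trace_mul_comm]
  -- the square of the `11` block
  have ea : ((flucCov H Q * H₁ + minOp H Q * Q₁) * (flucCov H Q * H₁ + minOp H Q * Q₁)).trace =
      (flucCov H Q * H₁ * (flucCov H Q * H₁)).trace + 2 * (flucCov H Q * H₁ * (minOp H Q * Q₁)).trace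
        + (minOp H Q * Q₁ * (minOp H Q * Q₁)).trace := by
    rw [Matrix.add_mul, Matrix.mul_add, Matrix.mul_add, trace_add, trace_add, trace_add,
      trace_mul_comm (minOp H Q * Q₁) (flucCov H Q * H₁)]
    ring
  -- the mixed term: `tr(Γ Q₁ᵀ 𝓘ᵀ H₁) = tr(Γ H₁ 𝓘 Q₁)` by transposition (`Γ`, `H₁` symmetric)
  have eb : (flucCov H Q * Q₁ᵀ * ((minOp H Q)ᵀ * H₁ - effForm H Q * Q₁)).trace =
      (flucCov H Q * H₁ * (minOp H Q * Q₁)).trace - (effForm H Q * Q₁ * (flucCov H Q * Q₁ᵀ)).trace := by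
    rw [Matrix.mul_sub, trace_sub, trace_mul_comm (flucCov H Q * Q₁ᵀ) (effForm H Q * Q₁)]
    congr 1
    rw [← trace_transpose]
    simp only [transpose_mul, transpose_transpose, hΓ, hH₁, ← Matrix.mul_assoc]
    rw [trace_mul_comm _ (flucCov H Q)]
    simp only [← Matrix.mul_assoc]
  -- the square of the `22` block: `tr((𝓘ᵀQ₁ᵀ)²) = tr((𝓘Q₁)²)`
  have ed : ((minOp H Q)ᵀ * Q₁ᵀ * ((minOp H Q)ᵀ * Q₁ᵀ)).trace = (minOp H Q * Q₁ * (minOp H Q * Q₁)).trace := by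
    rw [← transpose_mul, ← transpose_mul, trace_transpose, Matrix.mul_assoc, trace_mul_comm Q₁]
    simp only [Matrix.mul_assoc]
  rw [e2, ea, eb, ed]
  ring

/-- [folklore] **THE SIX LOOPS OF THE ONE SHOT** (owner memo `GAMMA-DESIGN.md` §1, VERBATIM): for `Hᵀ = H`, `H₁ᵀ = H₁`,
`−½·secondVar (kkt H Q) (kkt H₁ Q₁) (kkt H₂ Q₂)`
`  = ½tr(Γ H₁ Γ H₁) − ½tr(Γ H₂) + 2tr(Γ H₁ 𝓘 Q₁) + tr(𝓘 Q₁ 𝓘 Q₁) − tr(𝔊·Q₁ Γ Q₁ᵀ) − tr(𝓘 Q₂)`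
(`Γ = flucCov H Q`, `𝓘 = minOp H Q`, `𝔊 = effForm H Q`; read `H₁, Q₁ ∕ H₂, Q₂` as `Ḣ, Q̇ ∕ Ḧ, Q̈`). -/
theorem sixLoops_kkt (H H₁ H₂ : Matrix ν ν ℝ) (Q Q₁ Q₂ : Matrix μ ν ℝ) (hH : Hᵀ = H) (hH₁ : H₁ᵀ = H₁) :
    -(1 / 2 : ℝ) * secondVar (kkt H Q) (kkt H₁ Q₁) (kkt H₂ Q₂) =
      (1 / 2 : ℝ) * (flucCov H Q * H₁ * (flucCov H Q * H₁)).trace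
        - (1 / 2 : ℝ) * (flucCov H Q * H₂).trace
        + 2 * (flucCov H Q * H₁ * (minOp H Q * Q₁)).trace
        + (minOp H Q * Q₁ * (minOp H Q * Q₁)).trace
        - (effForm H Q * (Q₁ * (flucCov H Q * Q₁ᵀ))).trace
        - (minOp H Q * Q₂).trace := by
  rw [secondVar_kkt H H₁ H₂ Q Q₁ Q₂ hH hH₁, ← Matrix.mul_assoc (effForm H Q)]
  ring

/-- [folklore] **CHECK 1 of the memo** («`Q̇ = 0 ⟹ ½tr(ΓḢΓḢ) − ½tr(ΓḦ)`»): with a STATIC constraint (`Q₁ = Q₂ = 0`) only the pure gluon pair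
survives: `−½·secondVar (kkt H Q) (kkt H₁ 0) (kkt H₂ 0) = ½tr(Γ H₁ Γ H₁) − ½tr(Γ H₂)`. -/
theorem sixLoops_kkt_of_Q_static (H H₁ H₂ : Matrix ν ν ℝ) (Q : Matrix μ ν ℝ) (hH : Hᵀ = H) (hH₁ : H₁ᵀ = H₁) :
    -(1 / 2 : ℝ) * secondVar (kkt H Q) (kkt H₁ (0 : Matrix μ ν ℝ)) (kkt H₂ (0 : Matrix μ ν ℝ)) =
      (1 / 2 : ℝ) * (flucCov H Q * H₁ * (flucCov H Q * H₁)).trace - (1 / 2 : ℝ) * (flucCov H Q * H₂).trace := by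
  rw [sixLoops_kkt H H₁ H₂ Q 0 0 hH hH₁]
  simp only [Matrix.mul_zero, Matrix.zero_mul, trace_zero, mul_zero, add_zero, sub_zero]

end Second

/-! ## §2 Calculus: the 2-jet of `−½·log|det kkt(H(t),Q(t))|` along a `C²` curve -/

section Calculus

variable {ν μ : Type*} [Fintype ν] [Fintype μ] [DecidableEq ν] [DecidableEq μ]

/-- [folklore] **FIRST VARIATION ALONG A CURVE**: if `u ↦ H u`, `u ↦ Q u` have derivatives `H₁`, `Q₁` at `t`, `H t` is symmetric and Bałaban's
bordered matrix is non-degenerate at `t`, then `(log|det kkt(H,Q)|)′(t) = tr(Γ_t·H₁) + 2·tr(𝓘_t·Q₁)`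
(`Γ_t = flucCov (H t) (Q t)`, `𝓘_t = minOp (H t) (Q t)`). -/
theorem hasDerivAt_logAbsDet_kkt {H : ℝ → ν → ν → ℝ} {Q : ℝ → μ → ν → ℝ} {H₁ : Matrix ν ν ℝ} {Q₁ : Matrix μ ν ℝ} {t : ℝ}
    (hH : HasDerivAt H (Matrix.of.symm H₁) t) (hQ : HasDerivAt Q (Matrix.of.symm Q₁) t)
    (hsym : (Matrix.of (H t))ᵀ = Matrix.of (H t)) (hdet : (kkt (Matrix.of (H t)) (Matrix.of (Q t))).det ≠ 0) :
    HasDerivAt (fun u => Real.log |(kkt (Matrix.of (H u)) (Matrix.of (Q u))).det|)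
      ((flucCov (Matrix.of (H t)) (Matrix.of (Q t)) * H₁).trace + 2 * (minOp (Matrix.of (H t)) (Matrix.of (Q t)) * Q₁).trace) t := by
  have hK := hasDerivAt_kkt hH hQ
  have h := hasDerivAt_logAbsDet (A := fun u => Matrix.of.symm (kkt (Matrix.of (H u)) (Matrix.of (Q u)))) (A₁ := kkt H₁ Q₁) hK hdet
  rw [← trace_kktInv_mul_kkt_symm _ H₁ _ Q₁ hsym]
  exact h

/-- [folklore] The `−½` multiple: `(−½·log|det kkt(H,Q)|)′(t) = −½tr(Γ_t·H₁) − tr(𝓘_t·Q₁)`. -/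
theorem hasDerivAt_negHalfLogAbsDet_kkt {H : ℝ → ν → ν → ℝ} {Q : ℝ → μ → ν → ℝ} {H₁ : Matrix ν ν ℝ} {Q₁ : Matrix μ ν ℝ} {t : ℝ}
    (hH : HasDerivAt H (Matrix.of.symm H₁) t) (hQ : HasDerivAt Q (Matrix.of.symm Q₁) t)
    (hsym : (Matrix.of (H t))ᵀ = Matrix.of (H t)) (hdet : (kkt (Matrix.of (H t)) (Matrix.of (Q t))).det ≠ 0) :
    HasDerivAt (fun u => -(1 / 2 : ℝ) * Real.log |(kkt (Matrix.of (H u)) (Matrix.of (Q u))).det|)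
      (-(1 / 2 : ℝ) * (flucCov (Matrix.of (H t)) (Matrix.of (Q t)) * H₁).trace
        - (minOp (Matrix.of (H t)) (Matrix.of (Q t)) * Q₁).trace) t := by
  refine ((hasDerivAt_logAbsDet_kkt hH hQ hsym hdet).const_mul (-(1 / 2 : ℝ))).congr_deriv ?_
  ring

/-- [folklore] **SECOND VARIATION ALONG A CURVE, abstract value**: if `H`, `Q` have derivatives `H₁ t`, `Q₁ t` at `t`, the first jets `H₁`, `Q₁`
have derivatives `H₂`, `Q₂` at `t`, and `det kkt(H t)(Q t) ≠ 0`, then the first-variation density `u ↦ tr(kkt(H u,Q u)⁻¹·kkt(H₁ u,Q₁ u))` has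
derivative `secondVar (kkt (H t) (Q t)) (kkt (H₁ t) (Q₁ t)) (kkt H₂ Q₂)` at `t` (`LogDetSecondVariation.hasDerivAt_trace_inv_mul` on the
bordered curve, whose jets are bordered by `SliceTransferModel.hasDerivAt_kkt`). -/
theorem hasDerivAt_firstVar_kkt {H H₁ : ℝ → ν → ν → ℝ} {H₂ : Matrix ν ν ℝ} {Q Q₁ : ℝ → μ → ν → ℝ} {Q₂ : Matrix μ ν ℝ} {t : ℝ}
    (hH : HasDerivAt H (H₁ t) t) (hH₁ : HasDerivAt H₁ (Matrix.of.symm H₂) t)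
    (hQ : HasDerivAt Q (Q₁ t) t) (hQ₁ : HasDerivAt Q₁ (Matrix.of.symm Q₂) t)
    (hdet : (kkt (Matrix.of (H t)) (Matrix.of (Q t))).det ≠ 0) :
    HasDerivAt (fun u => ((kkt (Matrix.of (H u)) (Matrix.of (Q u)))⁻¹ * kkt (Matrix.of (H₁ u)) (Matrix.of (Q₁ u))).trace)
      (secondVar (kkt (Matrix.of (H t)) (Matrix.of (Q t))) (kkt (Matrix.of (H₁ t)) (Matrix.of (Q₁ t))) (kkt H₂ Q₂)) t := by
  have hH' : HasDerivAt H (Matrix.of.symm (Matrix.of (H₁ t))) t := hH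
  have hQ' : HasDerivAt Q (Matrix.of.symm (Matrix.of (Q₁ t))) t := hQ
  have hK : HasDerivAt (fun u => Matrix.of.symm (kkt (Matrix.of (H u)) (Matrix.of (Q u))))
      ((fun u => Matrix.of.symm (kkt (Matrix.of (H₁ u)) (Matrix.of (Q₁ u)))) t) t := hasDerivAt_kkt hH' hQ'
  have hK₁ : HasDerivAt (fun u => Matrix.of.symm (kkt (Matrix.of (H₁ u)) (Matrix.of (Q₁ u)))) (Matrix.of.symm (kkt H₂ Q₂)) t :=
    hasDerivAt_kkt hH₁ hQ₁
  exact hasDerivAt_trace_inv_mul hK hK₁ hdet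

/-- [folklore] **THE ONE SHOT IN KKT FORM** (owner memo `GAMMA-DESIGN.md` §1): along a `C²` curve `u ↦ (H u, Q u)` with `H t`, `H₁ t` symmetric and
`det kkt(H t)(Q t) ≠ 0`, the first variation `u ↦ −½·tr(kkt(H u,Q u)⁻¹·kkt(H₁ u,Q₁ u))` of `−½·log|det kkt|` (see `hasDerivAt_negHalfLogAbsDet_kkt`)
has derivative at `t` equal to the SIX LOOPS
`T^{gl} = ½tr(ΓḢΓḢ) − ½tr(ΓḦ) + 2tr(ΓḢ𝓘Q̇) + tr(𝓘Q̇𝓘Q̇) − tr(𝔊·Q̇ΓQ̇ᵀ) − tr(𝓘Q̈)`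
with `Γ, 𝓘, 𝔊` the blocks of `(kkt (H t) (Q t))⁻¹` and `Ḣ, Q̇, Ḧ, Q̈ = H₁ t, Q₁ t, H₂, Q₂`. -/
theorem hasDerivAt_negHalfFirstVar_kkt {H H₁ : ℝ → ν → ν → ℝ} {H₂ : Matrix ν ν ℝ} {Q Q₁ : ℝ → μ → ν → ℝ} {Q₂ : Matrix μ ν ℝ} {t : ℝ}
    (hH : HasDerivAt H (H₁ t) t) (hH₁ : HasDerivAt H₁ (Matrix.of.symm H₂) t)
    (hQ : HasDerivAt Q (Q₁ t) t) (hQ₁ : HasDerivAt Q₁ (Matrix.of.symm Q₂) t)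
    (hsym : (Matrix.of (H t))ᵀ = Matrix.of (H t)) (hsym₁ : (Matrix.of (H₁ t))ᵀ = Matrix.of (H₁ t))
    (hdet : (kkt (Matrix.of (H t)) (Matrix.of (Q t))).det ≠ 0) :
    HasDerivAt (fun u => -(1 / 2 : ℝ) * ((kkt (Matrix.of (H u)) (Matrix.of (Q u)))⁻¹ * kkt (Matrix.of (H₁ u)) (Matrix.of (Q₁ u))).trace)
      ((1 / 2 : ℝ) * (flucCov (Matrix.of (H t)) (Matrix.of (Q t)) * Matrix.of (H₁ t) * (flucCov (Matrix.of (H t)) (Matrix.of (Q t)) * Matrix.of (H₁ t))).trace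
        - (1 / 2 : ℝ) * (flucCov (Matrix.of (H t)) (Matrix.of (Q t)) * H₂).trace
        + 2 * (flucCov (Matrix.of (H t)) (Matrix.of (Q t)) * Matrix.of (H₁ t) * (minOp (Matrix.of (H t)) (Matrix.of (Q t)) * Matrix.of (Q₁ t))).trace
        + (minOp (Matrix.of (H t)) (Matrix.of (Q t)) * Matrix.of (Q₁ t) * (minOp (Matrix.of (H t)) (Matrix.of (Q t)) * Matrix.of (Q₁ t))).trace
        - (effForm (Matrix.of (H t)) (Matrix.of (Q t)) * (Matrix.of (Q₁ t) * (flucCov (Matrix.of (H t)) (Matrix.of (Q t)) * (Matrix.of (Q₁ t))ᵀ))).trace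
        - (minOp (Matrix.of (H t)) (Matrix.of (Q t)) * Q₂).trace) t := by
  have h := (hasDerivAt_firstVar_kkt hH hH₁ hQ hQ₁ hdet).const_mul (-(1 / 2 : ℝ))
  rw [sixLoops_kkt _ _ H₂ _ _ Q₂ hsym hsym₁] at h
  exact h

end Calculus

end Summit.QuantumFields.BalabanUV.Beta.FP.KKTSecondVariation

end

/-! ## §3 (v1.1, append-only) The packaged 2-jet of `−½·log|det kkt(H,Q)|` along a `C²` curve -/

namespace Summit.QuantumFields.BalabanUV.Beta.FP.KKTSecondVariation

open Matrix Filter Finset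
open scoped Topology
open Literature.MathematicalPhysics.QuantumFieldTheory.Balaban1983to89.Beta.Composition (kkt)
open Literature.MathematicalPhysics.QuantumFieldTheory.Balaban1983to89.Beta.CompositionSingular (effForm minOp flucCov)
open Literature.Analysis.Calculus (eventually_det_ne_zero)
open Summit.QuantumFields.BalabanUV.Beta.D1BFx.SliceTransferModel (hasDerivAt_kkt)

variable {ν μ : Type*} [Fintype ν] [Fintype μ] [DecidableEq ν] [DecidableEq μ]

/-- [folklore] **THE ONE SHOT IN KKT FORM, PACKAGED AS A 2-JET** (the `hasDerivAt_oneShot_kkt` of the INTENT, journal l.23740; answers the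
pre-read INFO (i) of t4-ne9-formalise-leaf-05-g34, l.23815).  Data: `C²` curves `u ↦ H u` (symmetric near `t`), `u ↦ Q u` with first jets `H₁ u`,
`Q₁ u` near `t` and second jets `H₂`, `Q₂` at `t`, `H₁ t` symmetric, Bałaban's bordered matrix non-degenerate at `t`.  Then, with
`f u := −½·log|det kkt(H u)(Q u)|` and the FIRST VARIATION IN BLOCKS `g u := −½tr(Γ_u·H₁ u) − tr(𝓘_u·Q₁ u)`:
(i) `f′ = g` on a neighbourhood of `t` (the bordered determinant stays non-zero near `t`, `eventually_det_ne_zero`), and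
(ii) `g′(t) = T^{gl}` = the SIX LOOPS `½tr(ΓḢΓḢ) − ½tr(ΓḦ) + 2tr(ΓḢ𝓘Q̇) + tr(𝓘Q̇𝓘Q̇) − tr(𝔊·Q̇ΓQ̇ᵀ) − tr(𝓘Q̈)` at `t` —
i.e. `δ²(−½log|det 𝕂|) = T^{gl}` as a statement about an honest twice-differentiable real function. -/
theorem hasDerivAt_oneShot_kkt {H H₁ : ℝ → ν → ν → ℝ} {H₂ : Matrix ν ν ℝ} {Q Q₁ : ℝ → μ → ν → ℝ} {Q₂ : Matrix μ ν ℝ} {t : ℝ}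
    (hH : ∀ᶠ u in 𝓝 t, HasDerivAt H (H₁ u) u) (hH₁ : HasDerivAt H₁ (Matrix.of.symm H₂) t)
    (hQ : ∀ᶠ u in 𝓝 t, HasDerivAt Q (Q₁ u) u) (hQ₁ : HasDerivAt Q₁ (Matrix.of.symm Q₂) t)
    (hsym : ∀ᶠ u in 𝓝 t, (Matrix.of (H u))ᵀ = Matrix.of (H u)) (hsym₁ : (Matrix.of (H₁ t))ᵀ = Matrix.of (H₁ t))
    (hdet : (kkt (Matrix.of (H t)) (Matrix.of (Q t))).det ≠ 0) :
    (∀ᶠ u in 𝓝 t, HasDerivAt (fun v => -(1 / 2 : ℝ) * Real.log |(kkt (Matrix.of (H v)) (Matrix.of (Q v))).det|)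
        (-(1 / 2 : ℝ) * (flucCov (Matrix.of (H u)) (Matrix.of (Q u)) * Matrix.of (H₁ u)).trace
          - (minOp (Matrix.of (H u)) (Matrix.of (Q u)) * Matrix.of (Q₁ u)).trace) u)
    ∧ HasDerivAt (fun u => -(1 / 2 : ℝ) * (flucCov (Matrix.of (H u)) (Matrix.of (Q u)) * Matrix.of (H₁ u)).trace
          - (minOp (Matrix.of (H u)) (Matrix.of (Q u)) * Matrix.of (Q₁ u)).trace)
      ((1 / 2 : ℝ) * (flucCov (Matrix.of (H t)) (Matrix.of (Q t)) * Matrix.of (H₁ t) * (flucCov (Matrix.of (H t)) (Matrix.of (Q t)) * Matrix.of (H₁ t))).trace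
        - (1 / 2 : ℝ) * (flucCov (Matrix.of (H t)) (Matrix.of (Q t)) * H₂).trace
        + 2 * (flucCov (Matrix.of (H t)) (Matrix.of (Q t)) * Matrix.of (H₁ t) * (minOp (Matrix.of (H t)) (Matrix.of (Q t)) * Matrix.of (Q₁ t))).trace
        + (minOp (Matrix.of (H t)) (Matrix.of (Q t)) * Matrix.of (Q₁ t) * (minOp (Matrix.of (H t)) (Matrix.of (Q t)) * Matrix.of (Q₁ t))).trace
        - (effForm (Matrix.of (H t)) (Matrix.of (Q t)) * (Matrix.of (Q₁ t) * (flucCov (Matrix.of (H t)) (Matrix.of (Q t)) * (Matrix.of (Q₁ t))ᵀ))).trace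
        - (minOp (Matrix.of (H t)) (Matrix.of (Q t)) * Q₂).trace) t := by
  -- the bordered determinant stays non-zero near `t`
  have hH' : ∀ᶠ u in 𝓝 t, HasDerivAt H (Matrix.of.symm (Matrix.of (H₁ u))) u := hH
  have hQ' : ∀ᶠ u in 𝓝 t, HasDerivAt Q (Matrix.of.symm (Matrix.of (Q₁ u))) u := hQ
  have hK : HasDerivAt (fun u => Matrix.of.symm (kkt (Matrix.of (H u)) (Matrix.of (Q u))))
      (Matrix.of.symm (kkt (Matrix.of (H₁ t)) (Matrix.of (Q₁ t)))) t := hasDerivAt_kkt hH.self_of_nhds hQ.self_of_nhds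
  have hdet' : ∀ᶠ u in 𝓝 t, (Matrix.of (Matrix.of.symm (kkt (Matrix.of (H u)) (Matrix.of (Q u))))).det ≠ 0 :=
    eventually_det_ne_zero hK.hasFDerivAt hdet
  refine ⟨?_, ?_⟩
  · filter_upwards [hH', hQ', hsym, hdet'] with u huH huQ husym hudet
    exact hasDerivAt_negHalfLogAbsDet_kkt huH huQ husym hudet
  · -- (ii): the block form of the first variation agrees with `−½tr(𝕂⁻¹𝕂̇)` near `t` (symmetry of `H u`), then `hasDerivAt_negHalfFirstVar_kkt`
    have heq : ∀ᶠ u in 𝓝 t, -(1 / 2 : ℝ) * ((kkt (Matrix.of (H u)) (Matrix.of (Q u)))⁻¹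
        * kkt (Matrix.of (H₁ u)) (Matrix.of (Q₁ u))).trace
        = -(1 / 2 : ℝ) * (flucCov (Matrix.of (H u)) (Matrix.of (Q u)) * Matrix.of (H₁ u)).trace
          - (minOp (Matrix.of (H u)) (Matrix.of (Q u)) * Matrix.of (Q₁ u)).trace := by
      filter_upwards [hsym] with u husym
      rw [trace_kktInv_mul_kkt_symm _ _ _ _ husym]
      ring
    exact (hasDerivAt_negHalfFirstVar_kkt hH.self_of_nhds hH₁ hQ.self_of_nhds hQ₁ hsym.self_of_nhds hsym₁ hdet).congr_of_eventuallyEq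
      (heq.mono fun u hu => hu.symm)

end Summit.QuantumFields.BalabanUV.Beta.FP.KKTSecondVariation
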